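import Summits.ValiantsHypothesis.ValiantsHypothesis.Theorems.BarrierLeverAnchoredDoorHitsLowerPairsXElimDefs
import Summits.ValiantsHypothesis.ValiantsHypothesis.Theorems.BarrierLeverAnchoredDoorHitsLowerPairsRelApexSpec

/-!
# Support item `AnchoredDoorHitsLowerPairs` (stmt-ValiantsHypothesis-22510), line `anchored-peeling`:
# THE X-ELIMINATION SPLIT — truncation at a variable, the level-`a` specialisation (new `a`-roots on chosen blocks, scaled `a`-tails on chosen
# labels), and the two row readings (part 2 of the x-elimination recursion for Conjecture Z)

Helper file (`--supports stmt-ValiantsHypothesis-22510`; cell valiant-natproofs, rung V4, 𝒟-side door (c); registered line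
`Cruxes/AnchoredDoorHitsLowerPairs/Lines/anchored_peeling.lean` v26; node `Stmt.stub_conjZ` (p695484); prover seat val-np-p1 gen 26; memo
HOME/val-np-p1/g26/MEMO-conjZ-node-valnp1-g26.md §4). Closes NO item. Sequel of `…XElimDefs` (labelled columns `(L, W)`, `colE = E_L · t_W`, `entry`).

THE SPLIT AT THE VARIABLE `a` (memo g25 §12, in the labelled form of memo g26 §4). From arbitrary «base» parameters `(Θ⁰, Φ⁰, Ψ⁰)`, block weights
`cB : Finset (Fin h) → ℂ` and label weights `cL : Anchor h → ℂ`, the LEVEL parameters (`lvTheta`, `lvPhi`, `lvPsi`) are: the anchor `({a} | B)` gets the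
weight `cB B` and, as its `x`-tails, the tails `Ψ⁰ ({a}|B) ·` of the LABEL `({a} | B)`; every other anchor whose root contains `a` gets weight `0`; no anchor
has an `a`-tail; the label `ℓ` gets the `a`-tail `cL ℓ`; everything else is `(Θ⁰, Φ⁰, Ψ⁰)`. Then:
* `entry_tr` (**truncation**): rows avoiding `a` do not see the parameters at `a` (`killVars_colE`);
* `entry_lv_of_notMem` (**row reading off `a`**): on a row `U ∌ a` the level parameters read like the base parameters;
* the ingredients of the ROW READING THROUGH `a` (sequel `…XElimRow`, `entry_lv_insert`): `blocks W` = the pairs `⊆ W` and, if `|W|` is odd, the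
  singletons `⊆ W`; the anchor sets of `W` through the anchor `({a}|B)` are in bijection with the anchor sets of `W \ B` (`erase_mem_jSet`,
  `insert_mem_jSet`); two `a`-rooted anchors give `x_a²` (`coeff_eq_zero_of_two_roots`); readings through `a` of `x_a`-free polynomials times `a`-tails
  (`coeff_insert_mul_tails`) and of `x_a · G` (`coeff_insert_X_mul`).

WHAT THIS IS NOT: the row reading, the determinant step and the recursion are in the sequels; nothing on crux stmt-ValiantsHypothesis-14610 or on `VP` versus `VNP`.
-/

set_option linter.dupNamespace false

namespace Summit.ValiantsHypothesis.ValiantsHypothesis.Theorems.BarrierLever.AnchoredPeeling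

open Finset MvPolynomial
open Summit.ValiantsHypothesis.ValiantsHypothesis.Theorems.BarrierLever.BrickCalculus (pexpo pexpo_def pexpo_le_iff pexpo_sub
  pexpo_apply_castAdd pexpo_apply_natAdd)

noncomputable section

namespace XElim

variable {h : ℕ}

/-! ## 1. Truncation at `a` and the level-`a` specialisation -/

section Params

variable (a : Fin h)

/-- Truncated weights: anchors whose root contains `a` get weight `0`. -/
def trTheta (Θ : Anchor h → ℂ) : Anchor h → ℂ := fun α => if a ∈ α.1 then 0 else Θ α

/-- Truncated anchor tails: no `a`-tails, and no tails at all on anchors rooted through `a`. -/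
def trPhi (Φ : Anchor h → Fin h → ℂ) : Anchor h → Fin h → ℂ := fun α b => if b = a ∨ a ∈ α.1 then 0 else Φ α b

/-- Truncated label tails: no `a`-tails. -/
def trPsi (Ψ : Anchor h → Fin h → ℂ) : Anchor h → Fin h → ℂ := fun ℓ b => if b = a then 0 else Ψ ℓ b

/-- LEVEL weights: `({a}|B) ↦ cB B`, other `a`-rooted anchors `↦ 0`, the rest `Θ⁰`. -/
def lvTheta (Θ₀ : Anchor h → ℂ) (cB : Finset (Fin h) → ℂ) : Anchor h → ℂ :=
  fun α => if a ∈ α.1 then (if α.1 = {a} then cB α.2 else 0) else Θ₀ α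

/-- LEVEL anchor tails: no `a`-tails; the anchor `({a}|B)` carries the tails of the LABEL `({a}|B)`; the rest `Φ⁰`. -/
def lvPhi (Φ₀ Ψ₀ : Anchor h → Fin h → ℂ) : Anchor h → Fin h → ℂ :=
  fun α b => if b = a then 0 else (if α.1 = {a} then Ψ₀ α b else Φ₀ α b)

/-- LEVEL label tails: the `a`-tail of the label `ℓ` is `cL ℓ`; the rest `Ψ⁰`. -/
def lvPsi (Ψ₀ : Anchor h → Fin h → ℂ) (cL : Anchor h → ℂ) : Anchor h → Fin h → ℂ :=
  fun ℓ b => if b = a then cL ℓ else Ψ₀ ℓ b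

variable (Θ₀ : Anchor h → ℂ) (Φ₀ Ψ₀ : Anchor h → Fin h → ℂ) (cB : Finset (Fin h) → ℂ) (cL : Anchor h → ℂ)

/-- Truncating the level weights gives the truncated base weights. -/
theorem trTheta_lv : trTheta a (lvTheta a Θ₀ cB) = trTheta a Θ₀ := by
  funext α; by_cases ha : a ∈ α.1 <;> simp [trTheta, lvTheta, ha]

/-- Truncating the level anchor tails gives the truncated base tails. -/
theorem trPhi_lv : trPhi a (lvPhi a Φ₀ Ψ₀) = trPhi a Φ₀ := by
  funext α b
  by_cases hb : b = a
  · simp [trPhi, hb]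
  · by_cases ha : a ∈ α.1
    · simp [trPhi, ha]
    · have hne : α.1 ≠ {a} := fun heq => ha (by rw [heq]; exact Finset.mem_singleton_self a)
      simp [trPhi, lvPhi, hb, ha, hne]

/-- Truncating the level label tails gives the truncated base tails. -/
theorem trPsi_lv : trPsi a (lvPsi a Ψ₀ cL) = trPsi a Ψ₀ := by
  funext ℓ b; by_cases hb : b = a <;> simp [trPsi, lvPsi, hb]

end Params

/-! ## 2. Killing `x_a`: the truncation lemma -/

section Kill

variable (a : Fin h) (Θ : Anchor h → ℂ) (Φ Ψ : Anchor h → Fin h → ℂ)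

/-- Killing `x_a` in a label exponential removes its `a`-tail. -/
theorem killVars_labE (ℓ : Anchor h) : ThinStep.killVars {Fin.castAdd h a} (labE Ψ ℓ) = labE (trPsi a Ψ) ℓ := by
  classical
  rw [labE, labE, map_prod]
  refine Finset.prod_congr rfl (fun b _ => ?_)
  rw [map_add, map_one, map_mul, ThinStep.killVars_C, ThinStep.killVars_X]
  by_cases hb : b = a
  · subst hb
    rw [if_pos (Finset.mem_singleton_self _), trPsi, if_pos rfl, mul_zero, C_0, zero_mul]
  · rw [if_neg (fun hmem => hb (Fin.castAdd_injective _ _ (Finset.mem_singleton.mp hmem))), trPsi, if_neg hb]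

/-- Killing `x_a` in the `x`-part of an anchor: `0` if the root contains `a`, else the `a`-tail is removed. -/
theorem killVars_xPartE (α : Anchor h) :
    ThinStep.killVars {Fin.castAdd h a} (xPartE Φ α) = if a ∈ α.1 then 0 else xPartE (trPhi a Φ) α := by
  classical
  rw [xPartE, map_mul, map_prod]
  by_cases ha : a ∈ α.1
  · rw [if_pos ha, Finset.prod_eq_zero ha, zero_mul]
    rw [ThinStep.killVars_X, if_pos (Finset.mem_singleton_self _)]
  · rw [if_neg ha, xPartE]
    congr 1
    · refine Finset.prod_congr rfl (fun b hb => ?_)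
      rw [ThinStep.killVars_X, if_neg (fun hmem => ha (by
        have hba := Fin.castAdd_injective _ _ (Finset.mem_singleton.mp hmem)
        rw [hba] at hb; exact hb))]
    · rw [tailE, tailE, map_prod]
      refine Finset.prod_congr rfl (fun b _ => ?_)
      rw [map_add, map_one, map_mul, ThinStep.killVars_C, ThinStep.killVars_X]
      by_cases hb : b = a
      · subst hb
        rw [if_pos (Finset.mem_singleton_self _), trPhi, if_pos (Or.inl rfl), mul_zero, C_0, zero_mul]
      · rw [if_neg (fun hmem => hb (Fin.castAdd_injective _ _ (Finset.mem_singleton.mp hmem))), trPhi, if_neg (not_or.mpr ⟨hb, ha⟩)]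

/-- Killing `x_a` in the product of the `x`-parts of an anchor set. -/
theorem killVars_prod_xPartE (J : Finset (Anchor h)) :
    ThinStep.killVars {Fin.castAdd h a} (∏ α ∈ J, xPartE Φ α) = if ∃ α ∈ J, a ∈ α.1 then 0 else ∏ α ∈ J, xPartE (trPhi a Φ) α := by
  classical
  rw [map_prod]
  by_cases hex : ∃ α ∈ J, a ∈ α.1
  · obtain ⟨α, hαJ, hα⟩ := hex
    rw [if_pos ⟨α, hαJ, hα⟩]
    exact Finset.prod_eq_zero hαJ (by rw [killVars_xPartE, if_pos hα])
  · rw [if_neg hex]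
    push Not at hex
    exact Finset.prod_congr rfl (fun α hα => by rw [killVars_xPartE, if_neg (hex α hα)])

/-- The truncated weight monomial of an anchor set: `0` if some root contains `a`, else the original one. -/
theorem prod_trTheta (J : Finset (Anchor h)) :
    (∏ α ∈ J, trTheta a Θ α) = if ∃ α ∈ J, a ∈ α.1 then 0 else ∏ α ∈ J, Θ α := by
  classical
  by_cases hex : ∃ α ∈ J, a ∈ α.1
  · obtain ⟨α, hαJ, hα⟩ := hex
    rw [if_pos ⟨α, hαJ, hα⟩]
    exact Finset.prod_eq_zero hαJ (by rw [trTheta, if_pos hα])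
  · rw [if_neg hex]
    push Not at hex
    exact Finset.prod_congr rfl (fun α hα => by rw [trTheta, if_neg (hex α hα)])

/-- **Killing `x_a` in a column element truncates the parameters.** -/
theorem killVars_colE (c : LCol h) :
    ThinStep.killVars {Fin.castAdd h a} (colE Θ Φ Ψ c) = colE (trTheta a Θ) (trPhi a Φ) (trPsi a Ψ) c := by
  classical
  rw [colE, colE, map_mul, map_prod, Finset.prod_congr rfl (fun ℓ _ => killVars_labE a Ψ ℓ), tW, tW, map_sum]
  congr 1
  refine Finset.sum_congr rfl (fun J _ => ?_)
  rw [map_mul, ThinStep.killVars_C, killVars_prod_xPartE, prod_trTheta]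
  by_cases hex : ∃ α ∈ J, a ∈ α.1
  · rw [if_pos hex, if_pos hex, mul_zero, C_0, zero_mul]
  · rw [if_neg hex, if_neg hex]

/-- **TRUNCATION LEMMA: a row avoiding `a` does not see the parameters at `a`.** -/
theorem entry_tr {U : Finset (Fin h)} (hU : a ∉ U) (c : LCol h) :
    entry (trTheta a Θ) (trPhi a Φ) (trPsi a Ψ) U c = entry Θ Φ Ψ U c := by
  classical
  rw [entry, entry, ← killVars_colE, ThinStep.coeff_killVars_of_disjoint]
  rw [Finset.disjoint_singleton_right, castAdd_mem_support_pexpo_iff]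
  exact hU

variable (Θ₀ : Anchor h → ℂ) (Φ₀ Ψ₀ : Anchor h → Fin h → ℂ) (cB : Finset (Fin h) → ℂ) (cL : Anchor h → ℂ)

/-- **Row reading off `a`: the level parameters read like the base parameters.** -/
theorem entry_lv_of_notMem {U : Finset (Fin h)} (hU : a ∉ U) (c : LCol h) :
    entry (lvTheta a Θ₀ cB) (lvPhi a Φ₀ Ψ₀) (lvPsi a Ψ₀ cL) U c = entry Θ₀ Φ₀ Ψ₀ U c := by
  rw [← entry_tr a _ _ _ hU, trTheta_lv, trPhi_lv, trPsi_lv, entry_tr a _ _ _ hU]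

end Kill

/-! ## 3. Blocks and the anchor sets through an `a`-rooted anchor -/

section Blocks

/-- The blocks of `W` occurring in maximum matchings: the pairs `⊆ W`, and the singletons `⊆ W` when `|W|` is odd. -/
def blocks (W : Finset (Fin h)) : Finset (Finset (Fin h)) :=
  W.powerset.filter (fun B => B.card = 2 ∨ (B.card = 1 ∧ ¬ 2 ∣ W.card))

/-- Membership in `blocks`. -/
theorem mem_blocks {W B : Finset (Fin h)} : B ∈ blocks W ↔ B ⊆ W ∧ (B.card = 2 ∨ (B.card = 1 ∧ ¬ 2 ∣ W.card)) := by
  rw [blocks, Finset.mem_filter, Finset.mem_powerset]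

/-- Membership in `jSet`. -/
theorem mem_jSet {W : Finset (Fin h)} {J : Finset (Anchor h)} :
    J ∈ jSet W ↔ J ⊆ anchors 2 h ∧ P2.YPart W J ∧ P2.nPairs J = W.card / 2 := by
  classical
  unfold jSet
  simp only [Finset.mem_filter, Finset.mem_powerset]

/-- Membership in `anchors 2 h`. -/
theorem mem_anchors_two {α : Anchor h} : α ∈ anchors 2 h ↔ 1 ≤ α.1.card ∧ α.1.card ≤ 2 ∧ 1 ≤ α.2.card ∧ α.2.card ≤ 2 := by
  simp only [anchors, Finset.mem_filter, Finset.mem_univ, true_and]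

/-- The size of `W` is `2·nPairs + #singletons` for an anchor set of profile 2 whose `y`-parts partition `W`. -/
theorem card_eq_of_yPart {W : Finset (Fin h)} {J : Finset (Anchor h)} (hJ : J ⊆ anchors 2 h) (hY : P2.YPart W J) :
    W.card = 2 * P2.nPairs J + (J.filter (fun α => α.2.card = 1)).card := by
  classical
  rw [← hY.2, P2.card_yFoot_eq_sum hY.1, P2.nPairs]
  have hsplit : ∀ α ∈ J, α.2.card = (if α.2.card = 2 then 2 else 0) + (if α.2.card = 1 then 1 else 0) := by
    intro α hα
    have hm := mem_anchors_two.mp (hJ hα)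
    by_cases h2 : α.2.card = 2
    · simp [h2]
    · have h1 : α.2.card = 1 := by omega
      simp [h1]
  rw [Finset.sum_congr rfl hsplit, Finset.sum_add_distrib, Finset.sum_ite, Finset.sum_ite, Finset.sum_const_zero, Finset.sum_const_zero,
    add_zero, add_zero, Finset.sum_const, Finset.sum_const, smul_eq_mul, smul_eq_mul, mul_comm]
  ring

variable {a : Fin h}

/-- **Erasing the anchor `({a}|B₀)` from an anchor set of `W` gives an anchor set of `W \ B₀`, and `B₀` is a block of `W`.** -/
theorem erase_mem_jSet {W : Finset (Fin h)} {J : Finset (Anchor h)} (hJ : J ∈ jSet W) {α₀ : Anchor h} (hα₀ : α₀ ∈ J) :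
    J.erase α₀ ∈ jSet (W \ α₀.2) ∧ α₀.2 ∈ blocks W := by
  classical
  obtain ⟨hsub, ⟨hdis, hfoot⟩, hnp⟩ := mem_jSet.mp hJ
  have hm := mem_anchors_two.mp (hsub hα₀)
  -- the y-foot splits
  have hfoot' : AnchorSets.yFoot J = α₀.2 ∪ AnchorSets.yFoot (J.erase α₀) := by
    conv_lhs => rw [← Finset.insert_erase hα₀]
    rw [AnchorSets.yFoot_insert]
  have hdisj : Disjoint α₀.2 (AnchorSets.yFoot (J.erase α₀)) := by
    rw [AnchorSets.yFoot, Finset.disjoint_biUnion_right]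
    intro β hβ
    exact hdis (Finset.mem_coe.mpr hα₀) (Finset.mem_coe.mpr (Finset.mem_of_mem_erase hβ)) (Finset.ne_of_mem_erase hβ).symm
  have hfootE : AnchorSets.yFoot (J.erase α₀) = W \ α₀.2 := by
    rw [← hfoot, hfoot', Finset.union_sdiff_left, Finset.sdiff_eq_self_of_disjoint hdisj.symm]
  have hB₀W : α₀.2 ⊆ W := by rw [← hfoot, hfoot']; exact Finset.subset_union_left
  -- pair count
  have hnp' : P2.nPairs J = P2.nPairs (J.erase α₀) + (if α₀.2.card = 2 then 1 else 0) := by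
    rw [P2.nPairs, P2.nPairs]
    conv_lhs => rw [← Finset.insert_erase hα₀]
    rw [Finset.filter_insert]
    by_cases h2 : α₀.2.card = 2
    · rw [if_pos h2, if_pos h2, Finset.card_insert_of_notMem (fun hmem => Finset.notMem_erase α₀ J (Finset.mem_of_mem_filter α₀ hmem))]
    · rw [if_neg h2, if_neg h2, add_zero]
  have hcardW := card_eq_of_yPart hsub ⟨hdis, hfoot⟩
  have hYE : P2.YPart (W \ α₀.2) (J.erase α₀) := ⟨hdis.subset (Finset.coe_subset.mpr (Finset.erase_subset α₀ J)), hfootE⟩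
  have hcardE : (W \ α₀.2).card = W.card - α₀.2.card := Finset.card_sdiff_of_subset hB₀W
  by_cases h2 : α₀.2.card = 2
  · rw [if_pos h2] at hnp'
    refine ⟨mem_jSet.mpr ⟨(Finset.erase_subset α₀ J).trans hsub, hYE, ?_⟩, mem_blocks.mpr ⟨hB₀W, Or.inl h2⟩⟩
    rw [hcardE, h2]; omega
  · have h1 : α₀.2.card = 1 := by omega
    rw [if_neg h2, add_zero] at hnp'
    -- `|W|` is odd: `α₀` is a singleton `y`-part
    have hsing : 1 ≤ (J.filter (fun α => α.2.card = 1)).card :=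
      Finset.card_pos.mpr ⟨α₀, Finset.mem_filter.mpr ⟨hα₀, h1⟩⟩
    have hodd : ¬ 2 ∣ W.card := by
      intro hdvd
      have hfilt : (J.filter (fun α => α.2.card = 1)).card = W.card - 2 * P2.nPairs J := by omega
      have : W.card / 2 * 2 = W.card := Nat.div_mul_cancel hdvd
      omega
    refine ⟨mem_jSet.mpr ⟨(Finset.erase_subset α₀ J).trans hsub, hYE, ?_⟩, mem_blocks.mpr ⟨hB₀W, Or.inr ⟨h1, hodd⟩⟩⟩
    rw [hcardE, h1, ← hnp', hnp]
    omega

/-- **Inserting the anchor `({a}|B)` into an anchor set of `W \ B` gives an anchor set of `W`** (for a block `B` of `W`). -/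
theorem insert_mem_jSet {W B : Finset (Fin h)} (hB : B ∈ blocks W) {J' : Finset (Anchor h)} (hJ' : J' ∈ jSet (W \ B)) :
    insert (({a} : Finset (Fin h)), B) J' ∈ jSet W ∧ (({a} : Finset (Fin h)), B) ∉ J' := by
  classical
  obtain ⟨hsub, ⟨hdis, hfoot⟩, hnp⟩ := mem_jSet.mp hJ'
  obtain ⟨hBW, hBc⟩ := mem_blocks.mp hB
  set α₀ : Anchor h := (({a} : Finset (Fin h)), B) with hα₀
  have hBne : B.Nonempty := Finset.card_pos.mp (by rcases hBc with h2 | ⟨h1, _⟩ <;> omega)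
  have hnot : α₀ ∉ J' := by
    intro hmem
    have hsubfoot : B ⊆ AnchorSets.yFoot J' := by
      intro x hx; rw [AnchorSets.yFoot, Finset.mem_biUnion]; exact ⟨α₀, hmem, hx⟩
    rw [hfoot] at hsubfoot
    obtain ⟨x, hx⟩ := hBne
    exact (Finset.mem_sdiff.mp (hsubfoot hx)).2 hx
  refine ⟨mem_jSet.mpr ⟨?_, ⟨?_, ?_⟩, ?_⟩, hnot⟩
  · intro α hα
    rcases Finset.mem_insert.mp hα with rfl | hα'
    · rw [mem_anchors_two]
      have h1a : ((({a} : Finset (Fin h)), B) : Anchor h).1.card = 1 := Finset.card_singleton a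
      have h2a : ((({a} : Finset (Fin h)), B) : Anchor h).2.card = B.card := rfl
      rw [h1a, h2a]
      rcases hBc with h2 | ⟨h1, _⟩ <;> omega
    · exact hsub hα'
  · -- pairwise disjoint y-parts
    rw [Finset.coe_insert]
    refine Set.PairwiseDisjoint.insert hdis (fun β hβ hne => ?_)
    have hβfoot : β.2 ⊆ W \ B := by
      rw [← hfoot]; intro x hx; rw [AnchorSets.yFoot, Finset.mem_biUnion]; exact ⟨β, hβ, hx⟩
    exact Finset.disjoint_of_subset_right hβfoot Finset.disjoint_sdiff
  · rw [AnchorSets.yFoot_insert, hfoot, Finset.union_sdiff_of_subset hBW]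
  · rw [P2.nPairs, Finset.filter_insert]
    have hcardE : (W \ B).card = W.card - B.card := Finset.card_sdiff_of_subset hBW
    have hBle : B.card ≤ W.card := Finset.card_le_card hBW
    rcases hBc with h2 | ⟨h1, hodd⟩
    · rw [if_pos h2, Finset.card_insert_of_notMem (fun hmem => hnot (Finset.mem_of_mem_filter α₀ hmem))]
      rw [P2.nPairs] at hnp; rw [hnp, hcardE, h2]; omega
    · have hne : ¬ (α₀.2.card = 2) := by rw [hα₀]; simp only; omega
      rw [if_neg hne]
      rw [P2.nPairs] at hnp; rw [hnp, hcardE, h1]; omega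

end Blocks

/-! ## 4. Small readings modulo `x_a²` -/

section Readings

variable (a : Fin h)

/-- `∏_{i ∈ s} (1 + c_i x_a) = 1 + (Σ c_i) x_a + x_a² · r` (any index type). -/
theorem prod_one_add_C_mul_X' {ι : Type*} (s : Finset ι) (c : ι → ℂ) :
    ∃ r : MvPolynomial (Fin (h + h)) ℂ,
      ∏ i ∈ s, (1 + C (c i) * X (Fin.castAdd h a)) = 1 + C (∑ i ∈ s, c i) * X (Fin.castAdd h a) + X (Fin.castAdd h a) ^ 2 * r := by
  classical
  induction s using Finset.induction_on with
  | empty => exact ⟨0, by simp⟩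
  | insert i s hi ih =>
    obtain ⟨r, hr⟩ := ih
    refine ⟨r * (1 + C (c i) * X (Fin.castAdd h a)) + C (∑ i' ∈ s, c i') * C (c i), ?_⟩
    rw [Finset.prod_insert hi, Finset.sum_insert hi, hr, C_add]
    ring

/-- **Reading through `a` of an `x_a`-free polynomial times `a`-tails:** `[x^{U'+a}] (P · ∏ (1 + c_i x_a)) = (Σ c_i) · [x^{U'}] P`. -/
theorem coeff_insert_mul_tails {ι : Type*} (s : Finset ι) (c : ι → ℂ) {P : MvPolynomial (Fin (h + h)) ℂ} (hP : XFree a P)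
    {U' : Finset (Fin h)} (hU' : a ∉ U') :
    coeff (pexpo (insert a U') ∅) (P * ∏ i ∈ s, (1 + C (c i) * X (Fin.castAdd h a))) = (∑ i ∈ s, c i) * coeff (pexpo U' ∅) P := by
  classical
  obtain ⟨r, hr⟩ := prod_one_add_C_mul_X' a s c
  rw [hr, mul_add, mul_add, mul_one, coeff_add, coeff_add]
  have h2 : coeff (pexpo (insert a U') ∅) (P * (X (Fin.castAdd h a) ^ 2 * r)) = 0 := by
    rw [mul_left_comm, coeff_pexpo_X_sq_mul (insert a U') ∅ (Fin.castAdd h a) (P * r)]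
  have h1 : coeff (pexpo (insert a U') ∅) (P * (C (∑ i ∈ s, c i) * X (Fin.castAdd h a))) = (∑ i ∈ s, c i) * coeff (pexpo U' ∅) P := by
    rw [show P * (C (∑ i ∈ s, c i) * X (Fin.castAdd h a)) = C (∑ i ∈ s, c i) * (X (Fin.castAdd h a) * P) by ring,
      coeff_C_mul, coeff_pexpo_X_mul, if_pos (Finset.mem_insert_self a U'), Finset.erase_insert hU']
  rw [h2, add_zero, h1, coeff_pexpo_eq_zero_of_xFree hP ∅ (Finset.mem_insert_self a U'), zero_add]

/-- **Reading through `a` of `x_a · G`:** `[x^{U'+a}] (x_a · G) = [x^{U'}] (G with x_a killed)`. -/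
theorem coeff_insert_X_mul (G : MvPolynomial (Fin (h + h)) ℂ) {U' : Finset (Fin h)} (hU' : a ∉ U') :
    coeff (pexpo (insert a U') ∅) (X (Fin.castAdd h a) * G) = coeff (pexpo U' ∅) (ThinStep.killVars {Fin.castAdd h a} G) := by
  classical
  rw [coeff_pexpo_X_mul, if_pos (Finset.mem_insert_self a U'), Finset.erase_insert hU', ThinStep.coeff_killVars_of_disjoint]
  rw [Finset.disjoint_singleton_right, castAdd_mem_support_pexpo_iff]
  exact hU'

/-- An `x`-part rooted through `a` is `x_a` times the rest. -/
theorem xPartE_eq_X_mul (Φ : Anchor h → Fin h → ℂ) {α : Anchor h} (hα : a ∈ α.1) :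
    xPartE Φ α = X (Fin.castAdd h a) * ((∏ b ∈ α.1.erase a, X (Fin.castAdd h b)) * tailE Φ α) := by
  rw [xPartE, ← Finset.mul_prod_erase _ _ hα, mul_assoc]

/-- **Two anchors rooted through `a` give no square-free reading.** -/
theorem coeff_eq_zero_of_two_roots (Φ : Anchor h → Fin h → ℂ) (G : MvPolynomial (Fin (h + h)) ℂ) {J : Finset (Anchor h)} {α₁ α₂ : Anchor h}
    (h₁ : α₁ ∈ J) (h₂ : α₂ ∈ J) (hne : α₁ ≠ α₂) (ha₁ : a ∈ α₁.1) (ha₂ : a ∈ α₂.1) (U : Finset (Fin h)) :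
    coeff (pexpo U ∅) (G * ∏ α ∈ J, xPartE Φ α) = 0 := by
  classical
  have h₂' : α₂ ∈ J.erase α₁ := Finset.mem_erase.mpr ⟨hne.symm, h₂⟩
  rw [← Finset.mul_prod_erase _ _ h₁, ← Finset.mul_prod_erase _ _ h₂', xPartE_eq_X_mul a Φ ha₁, xPartE_eq_X_mul a Φ ha₂]
  set x := X (R := ℂ) (Fin.castAdd h a)
  set P₁ := (∏ b ∈ α₁.1.erase a, X (R := ℂ) (Fin.castAdd h b)) * tailE Φ α₁
  set P₂ := (∏ b ∈ α₂.1.erase a, X (R := ℂ) (Fin.castAdd h b)) * tailE Φ α₂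
  set Q := ∏ α ∈ (J.erase α₁).erase α₂, xPartE Φ α
  rw [show G * (x * P₁ * (x * P₂ * Q)) = x ^ 2 * (G * P₁ * P₂ * Q) by ring]
  exact coeff_pexpo_X_sq_mul U ∅ (Fin.castAdd h a) _

end Readings

end XElim

end

end Summit.ValiantsHypothesis.ValiantsHypothesis.Theorems.BarrierLever.AnchoredPeeling
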